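import Summits.ValiantsHypothesis.ValiantsHypothesis.Theorems.KPlusLogSqLawTropicalBTightnessThreshold
import Summits.ValiantsHypothesis.ValiantsHypothesis.Theorems.KPlusLogSqLawTropicalShiftThreeTight

/-!
# Route «KPlusLogSqLaw», crux `TropicalB` (stmt-ValiantsHypothesis-19771) — the counting-tightness threshold: FLOOR `κ(m) ≥ 3` in the unsigned
# currency, and two NECESSARY CONDITIONS for tightness (dissociated exponents; exponent spread `≥ (C(m+K−1,m) − 1)/m`)

HONEST FRAMING.  Third companion of `…TropicalBTightnessThreshold` (seat val-sym-trop-p4 g12, cell `pub-symmetroid`, 2026-08-28;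
`--supports stmt-ValiantsHypothesis-19771 --as helper`), toward the registered stubs `stub_tropThin` / `stub_tropFat` of
`Cruxes/TropicalB/Lines/birth.lean`.  Census bookkeeping in the unsigned row currency `TropRowD` (`…TropicalBSplitDefs`): nothing here bears on
`TropicalB` in its window, `WeakLifting`, DoorA26 / DoorA34, `MatrixDescartes` (stmt-ValiantsHypothesis-18050) or VP ≠ VNP.

CONTENT (`(m, K)` counting-tight ⟺ `¬ TropRowD m K (multichoose K m − 2)` ⟺ some design has an unsigned dominant chain through all
`multichoose K m = C(m+K−1, m)` class multisets; `κ(m)` = the largest tight `K`, an initial segment by the companion file).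
* `three_classes_tight` — **`κ(m) ≥ 3` for every `m ≥ 1`**: the format `(m, 3)` is counting-tight (the tree's SHIFT-THREE-PLUS row
  `tropRootLawAt_three_iff : TropRootLawAt m 3 B ↔ C(m+2,2) − 1 ≤ B`, val-sym-lift-p3, read through `tropRootLawAt_of_tropRowD`);
  `two_classes_tight` — hence `(m, 2)` is tight as well (descent, `Tightness.not_tropRowD_tight_of_le`).
* `slope_injective_of_tight` — **a counting-tight chain forces DISSOCIATED exponents**: the slope map `M ↦ Σ_{l ∈ M} d l` is injective on the class
  multisets `Sym (Fin K) m` (every multiset is the multiset of exactly one chain term and slopes strictly increase along the chain).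
* `le_of_strictMono_range`, `multichoose_le_spread_of_tight` — **a counting-tight chain of a design with exponents in `[D₀, D₁]` has
  `multichoose K m ≤ m·(D₁ − D₀) + 1`**: tight designs are lacunary, with exponent spread at least `(C(m+K−1, m) − 1)/m` (the kernel cells comply:
  `(4,4) = 34` uses `(0,6,15,19)`, spread `19 ≥ 34/4`).
[this file; bookkeeping over the cited tree rows]
-/

set_option linter.dupNamespace false
set_option autoImplicit false

namespace Summit.ValiantsHypothesis.ValiantsHypothesis.Theorems.KPlusLogSqLaw

open Summit.ValiantsHypothesis.ValiantsHypothesis.Theorems.MatrixDescartes.Negative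
open Summit.ValiantsHypothesis.ValiantsHypothesis.Theorems.LacunarySymmetroidMatrixDescartes
open Summit.ValiantsHypothesis.ValiantsHypothesis.Theorems.LacunarySymmetroidMatrixDescartes.TropicalCensus
open scoped BigOperators
open Finset

namespace Tightness

variable {m K : ℕ}

/-! ### Floor: three classes are always counting-tight -/

/-- **`κ(m) ≥ 3`:** for every `m ≥ 1` the format `(m, 3)` is counting-tight (unsigned currency), by the tree's exact row
`T(m,3) = C(m+2,2) − 1` (SHIFT-THREE-PLUS, `tropRootLawAt_three_iff`). -/
theorem three_classes_tight (hm : 1 ≤ m) : ¬ TropRowD m 3 (Nat.multichoose 3 m - 2) := by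
  intro h
  have h1 := (tropRootLawAt_three_iff m _).mp (tropRootLawAt_of_tropRowD h)
  have h2 : Nat.multichoose 3 m = (m + 2).choose 2 := by
    rw [Nat.multichoose_eq, show 3 + m - 1 = m + 2 by omega, Nat.choose_symm_add]
  have h3 : 3 ≤ (m + 2).choose 2 := by
    calc 3 = Nat.choose 3 2 := by decide
      _ ≤ (m + 2).choose 2 := Nat.choose_le_choose 2 (by omega)
  omega

/-- `(m, 2)` is counting-tight for every `m ≥ 1` (descent from three classes). -/
theorem two_classes_tight (hm : 1 ≤ m) : ¬ TropRowD m 2 (Nat.multichoose 2 m - 2) :=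
  not_tropRowD_tight_of_le (le_refl 2) (by norm_num) (three_classes_tight hm)

/-! ### Necessary conditions for tightness -/

/-- **Tight ⇒ dissociated exponents.**  Along a counting-tight unsigned chain (`multichoose K m ≤ n + 1` terms, unique optima at strictly
increasing integer slopes, distinct consecutive terms) every class multiset is the multiset of exactly one term, so two different class
multisets have different exponent sums. -/
theorem slope_injective_of_tight {n : ℕ} (d : Fin K → ℕ) (v ε : Fin m → Fin m → Fin K → ℤ)
    (θ : Fin (n + 1) → ℤ) (p : Fin (n + 1) → Equiv.Perm (Fin m) × (Fin m → Fin K))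
    (hθ : StrictMono θ) (hdom : ∀ k, IsDominant d v ε (θ k) (p k)) (hne : ∀ k : Fin n, p k.castSucc ≠ p k.succ)
    (htight : Nat.multichoose K m ≤ n + 1) :
    Function.Injective fun M : Sym (Fin K) m => ((M : Multiset (Fin K)).map fun l => (d l : ℤ)).sum := by
  classical
  have hsm := slope_strictMono_of_chainD d v ε θ p hθ hdom hne
  set F : Fin (n + 1) → Sym (Fin K) m := fun k => classSym (p k) with hF
  have hinj : Function.Injective F := by
    intro k k' h
    apply hsm.injective
    simp only
    rw [slope_eq_of_classSym, slope_eq_of_classSym]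
    exact congrArg (fun M : Sym (Fin K) m => ((M : Multiset (Fin K)).map fun l => (d l : ℤ)).sum) h
  have hbij : Function.Bijective F := by
    rw [Fintype.bijective_iff_injective_and_card]
    refine ⟨hinj, le_antisymm (Fintype.card_le_of_injective F hinj) ?_⟩
    rw [Sym.card_sym_fin_eq_multichoose, Fintype.card_fin]; exact htight
  intro M M' hMM'
  obtain ⟨k, rfl⟩ := hbij.2 M
  obtain ⟨k', rfl⟩ := hbij.2 M'
  have hs : slope d (p k) = slope d (p k') := by
    rw [slope_eq_of_classSym, slope_eq_of_classSym]; exact hMM'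
  rw [hsm.injective hs]

/-- A strictly increasing integer sequence of length `n + 1` inside `[a, b]` forces `n ≤ b − a`. [arithmetic] -/
theorem le_of_strictMono_range {n : ℕ} (f : Fin (n + 1) → ℤ) (hf : StrictMono f) (a b : ℤ)
    (hlo : ∀ k, a ≤ f k) (hhi : ∀ k, f k ≤ b) : (n : ℤ) ≤ b - a := by
  have step : ∀ k : ℕ, (hk : k < n + 1) → f ⟨0, by omega⟩ + k ≤ f ⟨k, hk⟩ := by
    intro k
    induction k with
    | zero => intro hk; simp
    | succ k ih =>
      intro hk
      have h1 := ih (by omega)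
      have h2 : f ⟨k, by omega⟩ < f ⟨k + 1, hk⟩ := hf (by simp [Fin.lt_def])
      push_cast
      omega
  have h := step n (by omega)
  have h0 := hlo ⟨0, by omega⟩
  have hn := hhi ⟨n, by omega⟩
  omega

/-- **Tight ⇒ lacunary.**  A counting-tight unsigned chain of a design whose exponents lie in `[D₀, D₁]` has
`multichoose K m ≤ m·(D₁ − D₀) + 1`: the `multichoose K m` slopes are distinct integers in `[m·D₀, m·D₁]`. -/
theorem multichoose_le_spread_of_tight {n : ℕ} (d : Fin K → ℕ) (v ε : Fin m → Fin m → Fin K → ℤ)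
    (θ : Fin (n + 1) → ℤ) (p : Fin (n + 1) → Equiv.Perm (Fin m) × (Fin m → Fin K))
    (hθ : StrictMono θ) (hdom : ∀ k, IsDominant d v ε (θ k) (p k)) (hne : ∀ k : Fin n, p k.castSucc ≠ p k.succ)
    (htight : Nat.multichoose K m ≤ n + 1) (D₀ D₁ : ℕ) (hd : ∀ l, D₀ ≤ d l ∧ d l ≤ D₁) :
    Nat.multichoose K m ≤ m * (D₁ - D₀) + 1 := by
  have hsm := slope_strictMono_of_chainD d v ε θ p hθ hdom hne
  rcases le_or_gt D₀ D₁ with hD | hD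
  · have hlo : ∀ k, ((m * D₀ : ℕ) : ℤ) ≤ TropicalCensus.slope d (p k) := by
      intro k
      unfold TropicalCensus.slope
      calc ((m * D₀ : ℕ) : ℤ) = ∑ _i : Fin m, (D₀ : ℤ) := by simp
        _ ≤ ∑ i, (d ((p k).2 i) : ℤ) := Finset.sum_le_sum fun i _ => by exact_mod_cast (hd _).1
    have hhi : ∀ k, TropicalCensus.slope d (p k) ≤ ((m * D₁ : ℕ) : ℤ) := by
      intro k
      unfold TropicalCensus.slope
      calc ∑ i, (d ((p k).2 i) : ℤ) ≤ ∑ _i : Fin m, (D₁ : ℤ) := Finset.sum_le_sum fun i _ => by exact_mod_cast (hd _).2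
        _ = ((m * D₁ : ℕ) : ℤ) := by simp
    have h := le_of_strictMono_range (fun k => TropicalCensus.slope d (p k)) hsm _ _ hlo hhi
    have h2 : n ≤ m * (D₁ - D₀) := by
      zify [hD]
      push_cast at h
      linarith
    omega
  · -- `D₁ < D₀`: no class can exist, `K = 0`
    have hK : K = 0 := by
      by_contra hK
      have := hd ⟨0, Nat.pos_of_ne_zero hK⟩
      omega
    subst hK
    rcases m with _ | m
    · simp
    · rw [Nat.multichoose_zero_succ]; omega

end Tightness

end Summit.ValiantsHypothesis.ValiantsHypothesis.Theorems.KPlusLogSqLaw
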